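import Literature.NumberTheory.Automorphic.BrandtThetaSeriesHeckeAction
import Literature.NumberTheory.Automorphic.BrandtHeckeProjector
import Literature.NumberTheory.Automorphic.BrandtEigenvectorDegreeZero
import Literature.NumberTheory.Automorphic.EichlerSubidealCount
import Literature.NumberTheory.EllipticCurves.CongruenceNumber
import Literature.NumberTheory.EllipticCurves.HeckeCongruenceModulus
import Literature.NumberTheory.EllipticCurves.NewformsMultiplicityOneProofs
import Literature.NumberTheory.EllipticCurves.NewformsHeckeProofs
import Literature.NumberTheory.EllipticCurves.NewformsRealCoefficients
import Mathlib.NumberTheory.ModularForms.CuspFormSubmodule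
import HarnessLib

/-!
# Sketch (stub-ideation k=1 · GEN 10 · FAMILY 1 RECOGNISE & IMPORT) for `stub_xiDegreeComparison`
# of crux `SteinbergCore` (route-ABC-DefiniteXi, line `p6_tamagawa_split`):
# the IMPORT MAP — theta side typed end-to-end, composed with k2's PROVED kernel into k3's
# `XiCoreDivisibility`.

Companion to `STUB-IDEAS-stub_xiDegreeComparison-1.md` (gen 10).  What the three seats now hold:

* H1 `brandtTheta_sub_isCuspForm` — PROVED (k1 gen 9, `StubIdeasK1G9.thetaTransfer_H1`,
  `STUB_IDEAS_stub_xiDegreeComparison_1_g9_H1complete.lean`, 0 sorries).  Recorded here as the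
  `Prop` `H1` and consumed as a hypothesis `(hΘ : H1)` (crux workfiles are not importable).
* k2 gen 4 (`ThetaTransferG4`, all PROVED): the Brandt-free kernel (β)+(T)
  `dvd_natAbs_mul_congruenceNumber_of_transfer`, self-adjointness H4a′
  `peterssonProduct_anemicHecke_symm`, transport H4b′ `exists_anemicHecke_transport`, orthogonality
  (O) `peterssonProduct_transfer_eq_zero`.  Recorded here VERBATIM as the `Prop`s `KernelT`,
  `SelfAdjH4a`, `TransportH4b`, `OrthO` and consumed as hypotheses.
* k3 gen 4 (`ProbeExtremesG4`): `XiCoreDivisibility` (copied verbatim below) ⟹ stub modulo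
  {ARS 2.1(b), `FreyModularity`} by the Mazur-free tail L2 (PROVED) + L3/L5/L6/L7 (sorry, S/XS).

NEW in this file (k1-owned, the theta side = the only untyped stretch between H1 and the kernel) —
EVERYTHING BELOW IS PROVED (`lean check` rc 0, 0 sorries, axioms {propext, Classical.choice, Quot.sound}):
K1 `isCuspForm_sum_smul_brandtTheta` · the DEFINITION `thetaLift` (row theta lift on the degree-zero
lattice, by `Exists.choose` on H1) with its spec `coe_thetaLift` · K2b/K2c additivity & homogeneity ·
K2g degree preservation `sum_matrix_mulVec_eq_zero` · K2d `cuspCoeff_thetaLift` (`aₙ(Θ_i v) =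
2 w_i (B(n)v)_i`) · K2e integrality `thetaLift_mem_integralCuspForms0` · K2f `T_p`-equivariance
`heckeT_thetaLift` · K3 = H3 `thetaLift_eq_smul_of_isNewformOf` (`Θ_i(φ) = 2 w_i φ_i • f`, by strong
multiplicity one `mem_span_of_equiv_of_mem_newSubspace0` + `a₁`) · K5 the COMPOSITION
`xiCoreDivisibility_of_thetaSide : H1 → KernelT → SelfAdjH4a → TransportH4b → OrthO → XiCoreDivisibility`
(the interface test of the import map: level `Γ₀(N⁺N⁻)` vs `Γ₀(M)` by `subst`, `ξ ≠ 0` from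
`one_le_weight`, the ABSTRACT projector `Brandt.exists_heckeProjector` — NOT the setup form
`exists_heckeProjector_xi`, whose `adjoin` over ALL `B(n)` is too big for H4b′ — and the vacuous row
`φ_i = 0`) · §5b = k2's gen-4 kernel copied VERBATIM (namespace `KernelK2G4`, k2's work, here only so
the chain is kernel-checked in one file) · §5c the four templates ARE k2's theorems (`kernelT_holds`, …) ·
`xiCoreDivisibility_of_H1 : H1 → XiCoreDivisibility`.
The companion certificate `STUB_IDEAS_stub_xiDegreeComparison_1_g10_XiCoreComplete.lean` (= k1 g9 H1
file ++ this file ++ one line) proves `xiCoreDivisibility : XiCoreDivisibility` with NO hypotheses.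
-/

set_option linter.dupNamespace false

noncomputable section

namespace Summit.ABC.ABC.Cruxes.SteinbergCore.StubIdeasK1G10

open scoped MatrixGroups ModularForm Matrix
open CongruenceSubgroup
open Literature.NumberTheory.EllipticCurves Literature.NumberTheory.EllipticCurves.ModularForms
open Literature.NumberTheory.Automorphic Literature.NumberTheory.Automorphic.Brandt

/-! ## §1 H1 — differences of Brandt theta series are cusp forms (PROVED, k1 gen 9) -/

/-- **H1** verbatim (= `StubIdeasK1G9.thetaTransfer_H1` = k2 `ThetaTransferG3.brandtTheta_sub_isCuspForm`):
`Θ_ij − Θ_kl ∈ S₂(Γ₀(N⁺N⁻))`.  PROVED in `STUB_IDEAS_stub_xiDegreeComparison_1_g9_H1complete.lean`. -/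
def H1 : Prop :=
  ∀ (Nplus Nminus : ℕ) (S : XiSetup Nplus Nminus) [Fintype (ClassSet S.O)] (i j k l : ClassSet S.O),
    ModularForm.IsCuspForm (S.brandtTheta i j - S.brandtTheta k l)

variable {Nplus Nminus : ℕ}

/-! ## §2 K1 — degree-zero combinations of one theta row are cuspidal (PROVED from H1) -/

/-- **K1 (XS, PROVED).** `Σ_j v_j = 0 ⟹ Σ_j v_j Θ_ij ∈ S₂(Γ₀(N⁺N⁻))`:
`Σ_j v_j Θ_ij = Σ_j v_j (Θ_ij − Θ_ii)` and the cusp forms are a submodule. [folklore] -/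
theorem isCuspForm_sum_smul_brandtTheta (hΘ : H1) (S : XiSetup Nplus Nminus)
    [Fintype (ClassSet S.O)] (i : ClassSet S.O) {v : ClassSet S.O → ℤ} (hv : ∑ j, v j = 0) :
    ModularForm.IsCuspForm (∑ j, (v j : ℂ) • S.brandtTheta i j) := by
  have h0 : ∑ j, (v j : ℂ) • S.brandtTheta i i = 0 := by
    rw [← Finset.sum_smul, ← Int.cast_sum, hv, Int.cast_zero, zero_smul]
  have h : ∑ j, (v j : ℂ) • S.brandtTheta i j =
      ∑ j, (v j : ℂ) • (S.brandtTheta i j - S.brandtTheta i i) := by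
    simp_rw [smul_sub, Finset.sum_sub_distrib, h0, sub_zero]
  rw [h, ← ModularForm.mem_cuspFormSubmodule_iff]
  exact Submodule.sum_mem _ fun j _ => Submodule.smul_mem _ _ (hΘ Nplus Nminus S i j i i)

/-- From `IsCuspForm` to an honest `CuspForm` with the same underlying modular form
(`IsCuspForm f := f ∈ range toModularFormₗ`, definitional). [folklore] -/
theorem exists_cuspForm_of_isCuspForm {Γ : Subgroup (GL (Fin 2) ℝ)} [Γ.HasDetOne] {k : ℤ}
    {f : ModularForm Γ k} (h : ModularForm.IsCuspForm f) :
    ∃ g : CuspForm Γ k, (g : ModularForm Γ k) = f := h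

/-! ## §3 K2 — the row theta lift `Θ_i : ℤ[Cls O]⁰ → S₂(Γ₀(N⁺N⁻))` and its package -/

/-- **The row theta lift** `Θ_i(v) = Σ_j v_j Θ_ij` for `deg v = 0` (junk `0` off the degree-zero
lattice) — the `Θ` fed to k2's transfer template (T). [folklore] -/
def thetaLift (hΘ : H1) (S : XiSetup Nplus Nminus) [Fintype (ClassSet S.O)] (i : ClassSet S.O)
    (v : ClassSet S.O → ℤ) : CuspForm (Gamma0 (Nplus * Nminus)) 2 :=
  if hv : ∑ j, v j = 0 then
    (exists_cuspForm_of_isCuspForm (isCuspForm_sum_smul_brandtTheta hΘ S i hv)).choose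
  else 0

/-- **K2a (PROVED).** The underlying modular form of `Θ_i(v)` is `Σ_j v_j Θ_ij`. [folklore] -/
theorem coe_thetaLift (hΘ : H1) (S : XiSetup Nplus Nminus) [Fintype (ClassSet S.O)]
    (i : ClassSet S.O) {v : ClassSet S.O → ℤ} (hv : ∑ j, v j = 0) :
    ((thetaLift hΘ S i v : CuspForm (Gamma0 (Nplus * Nminus)) 2) :
        ModularForm (Gamma0 (Nplus * Nminus)) 2) = ∑ j, (v j : ℂ) • S.brandtTheta i j := by
  rw [thetaLift, dif_pos hv]
  exact (exists_cuspForm_of_isCuspForm (isCuspForm_sum_smul_brandtTheta hΘ S i hv)).choose_spec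

/-- Two cusp forms with the same underlying modular form are equal. [folklore] -/
theorem cuspForm_eq_of_coe_eq {Γ : Subgroup (GL (Fin 2) ℝ)} [Γ.HasDetOne] {k : ℤ}
    {g g' : CuspForm Γ k} (h : (g : ModularForm Γ k) = (g' : ModularForm Γ k)) : g = g' :=
  CuspForm.toModularFormₗ_injective h

/-- **K2b (XS, PROVED).** Additivity on the degree-zero lattice. [folklore] -/
theorem thetaLift_add (hΘ : H1) (S : XiSetup Nplus Nminus) [Fintype (ClassSet S.O)]
    (i : ClassSet S.O) (v v' : ClassSet S.O → ℤ) (hv : ∑ c, v c = 0) (hv' : ∑ c, v' c = 0) :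
    thetaLift hΘ S i (v + v') = thetaLift hΘ S i v + thetaLift hΘ S i v' := by
  have hvv' : ∑ c, (v + v') c = 0 := by
    simp only [Pi.add_apply, Finset.sum_add_distrib, hv, hv', add_zero]
  apply CuspForm.toModularFormₗ_injective
  rw [map_add, CuspForm.toModularFormₗ_eq_coe, CuspForm.toModularFormₗ_eq_coe,
    CuspForm.toModularFormₗ_eq_coe, coe_thetaLift hΘ S i hvv', coe_thetaLift hΘ S i hv,
    coe_thetaLift hΘ S i hv', ← Finset.sum_add_distrib]
  refine Finset.sum_congr rfl fun j _ => ?_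
  rw [Pi.add_apply, Int.cast_add, add_smul]

/-- **K2c (XS, PROVED).** `ℤ`-homogeneity on the degree-zero lattice. [folklore] -/
theorem thetaLift_smul (hΘ : H1) (S : XiSetup Nplus Nminus) [Fintype (ClassSet S.O)]
    (i : ClassSet S.O) (a : ℤ) (v : ClassSet S.O → ℤ) (hv : ∑ c, v c = 0) :
    thetaLift hΘ S i (a • v) = (a : ℂ) • thetaLift hΘ S i v := by
  have hav : ∑ c, (a • v) c = 0 := by
    simp only [Pi.smul_apply, smul_eq_mul, ← Finset.mul_sum, hv, mul_zero]
  apply CuspForm.toModularFormₗ_injective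
  rw [map_smul, CuspForm.toModularFormₗ_eq_coe, CuspForm.toModularFormₗ_eq_coe,
    coe_thetaLift hΘ S i hav, coe_thetaLift hΘ S i hv, Finset.smul_sum]
  refine Finset.sum_congr rfl fun j _ => ?_
  rw [Pi.smul_apply, smul_eq_mul, Int.cast_mul, smul_smul]

/-- **K2g (XS, PROVED).** `T(p)`, `p ∤ N⁺N⁻`, preserves the degree-zero lattice: the columns of
`T(p)` sum to `p + 1` (tree `XiSetup.sum_matrix_prime_eq`). [cite: Eichler1973, Ch. II §6 (16)] -/
theorem sum_matrix_mulVec_eq_zero (S : XiSetup Nplus Nminus) [Fintype (ClassSet S.O)] {p : ℕ}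
    (hp : p.Prime) (hpN : ¬ p ∣ Nplus * Nminus) {v : ClassSet S.O → ℤ} (hv : ∑ c, v c = 0) :
    ∑ c, (matrix S.O p *ᵥ v) c = 0 := by
  simp only [Matrix.mulVec, dotProduct]
  rw [Finset.sum_comm]
  simp_rw [← Finset.sum_mul, S.sum_matrix_prime_eq hp hpN, ← Finset.mul_sum, hv, mul_zero]

/-- **K2d (PROVED).** Fourier coefficients of the lift: `a_n(Θ_i v) = 2 w_i (T(n) v)_i` for `n ≥ 1`
(tree `XiSetup.qExpansion_coeff_sum_smul_brandtTheta` through `coe_thetaLift`; `cuspCoeff` is the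
`q`-expansion coefficient of the SAME function `⇑(Θ_i v) = ⇑(↑(Θ_i v) : ModularForm)`).
[cite: Voight2021, §41.1 (p. 752) and 41.1.3] -/
theorem cuspCoeff_thetaLift (hΘ : H1) (S : XiSetup Nplus Nminus) [Fintype (ClassSet S.O)]
    (i : ClassSet S.O) {v : ClassSet S.O → ℤ} (hv : ∑ j, v j = 0) {n : ℕ} (hn : n ≠ 0) :
    cuspCoeff (thetaLift hΘ S i v) n = ((2 * (weight S.O i : ℤ) * (matrix S.O n *ᵥ v) i : ℤ) : ℂ) := by
  have hcoe : ⇑(thetaLift hΘ S i v) =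
      ⇑(((thetaLift hΘ S i v : CuspForm (Gamma0 (Nplus * Nminus)) 2) :
        ModularForm (Gamma0 (Nplus * Nminus)) 2)) := rfl
  rw [cuspCoeff, hcoe, coe_thetaLift hΘ S i hv,
    S.qExpansion_coeff_sum_smul_brandtTheta i (fun j => (v j : ℂ)) hn, XiSetup.heckeFamily_apply]
  simp only [Matrix.mulVec, dotProduct, Matrix.map_apply, Int.coe_castRingHom]
  push_cast
  rfl

/-- **K2d₀ (PROVED).** `a_0(Θ_i v) = deg v = 0` (tree `XiSetup.qExpansion_coeff_zero_sum_smul_brandtTheta`). [folklore] -/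
theorem cuspCoeff_thetaLift_zero (hΘ : H1) (S : XiSetup Nplus Nminus) [Fintype (ClassSet S.O)]
    (i : ClassSet S.O) {v : ClassSet S.O → ℤ} (hv : ∑ j, v j = 0) :
    cuspCoeff (thetaLift hΘ S i v) 0 = 0 := by
  have hcoe : ⇑(thetaLift hΘ S i v) =
      ⇑(((thetaLift hΘ S i v : CuspForm (Gamma0 (Nplus * Nminus)) 2) :
        ModularForm (Gamma0 (Nplus * Nminus)) 2)) := rfl
  rw [cuspCoeff, hcoe, coe_thetaLift hΘ S i hv,
    S.qExpansion_coeff_zero_sum_smul_brandtTheta i (fun j => (v j : ℂ)), ← Int.cast_sum, hv,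
    Int.cast_zero]

/-- **K2e (PROVED).** Integrality: `Θ_i v ∈ S₂(Γ₀(N⁺N⁻); ℤ)` (from K2d, K2d₀). [folklore] -/
theorem thetaLift_mem_integralCuspForms0 (hΘ : H1) (S : XiSetup Nplus Nminus)
    [Fintype (ClassSet S.O)] (i : ClassSet S.O) {v : ClassSet S.O → ℤ} (hv : ∑ j, v j = 0) :
    thetaLift hΘ S i v ∈ integralCuspForms0 (Nplus * Nminus) 2 := by
  rw [mem_integralCuspForms0]
  intro n
  rcases eq_or_ne n 0 with rfl | hn
  · exact ⟨0, by rw [cuspCoeff_thetaLift_zero hΘ S i hv, Int.cast_zero]⟩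
  · exact ⟨_, (cuspCoeff_thetaLift hΘ S i hv hn).symm⟩

/-- **K2f (PROVED).** `T_p`-equivariance for `p ∤ N⁺N⁻`: `T_p (Θ_i v) = Θ_i (T(p) v)`
(tree `XiSetup.modHeckeT_sum_smul_brandtTheta` + `coe_modHeckeT_coe_cuspForm` + `coe_thetaLift`
twice, the second time at `T(p) v`, degree zero by K2g; `heckeFamily p (v ↦ ↑v_j) = ↑(T(p) v)` by
`XiSetup.heckeFamily_apply`). [cite: Pizer1980, §2 Prop. 2.23 and Remark 2.24] -/
theorem heckeT_thetaLift (hΘ : H1) (S : XiSetup Nplus Nminus) [Fintype (ClassSet S.O)]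
    [NeZero (Nplus * Nminus)] (i : ClassSet S.O) {p : ℕ} (hp : p.Prime)
    (hpN : ¬ p ∣ Nplus * Nminus) {v : ClassSet S.O → ℤ} (hv : ∑ c, v c = 0) :
    (haveI : NeZero p := ⟨hp.ne_zero⟩;
      heckeT (Gamma0 (Nplus * Nminus)) 2 p (thetaLift hΘ S i v)) =
      thetaLift hΘ S i (matrix S.O p *ᵥ v) := by
  haveI : NeZero p := ⟨hp.ne_zero⟩
  have hTv : ∑ c, (matrix S.O p *ᵥ v) c = 0 := sum_matrix_mulVec_eq_zero S hp hpN hv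
  refine DFunLike.coe_injective ?_
  have h1 : ⇑(heckeT (Gamma0 (Nplus * Nminus)) 2 p (thetaLift hΘ S i v)) =
      ⇑(modHeckeT (Gamma0 (Nplus * Nminus)) 2 p
        ((thetaLift hΘ S i v : CuspForm (Gamma0 (Nplus * Nminus)) 2) :
          ModularForm (Gamma0 (Nplus * Nminus)) 2)) :=
    (coe_modHeckeT_coe_cuspForm 2 p _).symm
  have h2 : ⇑(thetaLift hΘ S i (matrix S.O p *ᵥ v)) =
      ⇑(((thetaLift hΘ S i (matrix S.O p *ᵥ v) : CuspForm (Gamma0 (Nplus * Nminus)) 2) :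
        ModularForm (Gamma0 (Nplus * Nminus)) 2)) := rfl
  change ⇑(heckeT (Gamma0 (Nplus * Nminus)) 2 p (thetaLift hΘ S i v)) =
    ⇑(thetaLift hΘ S i (matrix S.O p *ᵥ v))
  rw [h1, h2, coe_thetaLift hΘ S i hv, coe_thetaLift hΘ S i hTv,
    S.modHeckeT_sum_smul_brandtTheta i hp hpN (fun j => (v j : ℂ))]
  congr 1
  refine Finset.sum_congr rfl fun k _ => ?_
  congr 1
  simp only [XiSetup.heckeFamily_apply, Matrix.mulVec, dotProduct, Matrix.map_apply,
    Int.coe_castRingHom]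
  push_cast
  rfl

/-! ## §4 K3 = H3 — the lift of the `a(E)`-eigenvector is `2 w_i φ_i · f` (multiplicity one) -/

/-- **K3 (PROVED).** If `f` is the newform of `W` at level `N⁺N⁻` and `φ` lies in the `a(W)`-eigen-lattice
of the Brandt matrices, then `Θ_i(φ) = (2 w_i φ_i) • f`.  Route: `deg φ = 0`
(`XiSetup.sum_eq_zero_of_mem_eigenLattice_lFunction'`); `T_p (Θ_i φ) = a_p • Θ_i φ` for `p ∤ N⁺N⁻`
(K2f + `hφ` + K2c); `T_p f = a_p • f` (`IsNewform0.heckeT_eq_coeff_smul` + `hf.2 p`); strong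
multiplicity one `mem_span_of_equiv_of_mem_newSubspace0 (IsNormalized.ne_zero_gamma0 hf.1.2.2) hf.1.1`
⟹ `Θ_i φ = c • f`; `a₁(Θ_i φ) = 2 w_i φ_i` (K2d at `n = 1`, `matrix_one`), `a₁(f) = 1`.
[cite: Knapp1993, Thm. 9.22] [cite: DiamondShurman2005, Prop. 5.8.5] -/
theorem thetaLift_eq_smul_of_isNewformOf (hΘ : H1) (S : XiSetup Nplus Nminus)
    [Fintype (ClassSet S.O)] [NeZero (Nplus * Nminus)] (i : ClassSet S.O)
    (W : WeierstrassCurve ℚ) [W.IsElliptic] {f : CuspForm (Gamma0 (Nplus * Nminus)) 2}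
    (hf : IsNewformOf W f) {φ : ClassSet S.O → ℤ}
    (hφ : φ ∈ eigenLattice (Nplus * Nminus) (matrix S.O) fun n => W.LFunction n) :
    thetaLift hΘ S i φ = ((2 * (weight S.O i : ℤ) * φ i : ℤ) : ℂ) • f := by
  classical
  have hφdeg : ∑ c, φ c = 0 := S.sum_eq_zero_of_mem_eigenLattice_lFunction' W hφ
  have hf0 : f ≠ 0 := IsNormalized.ne_zero_gamma0 hf.1.2.2
  -- `T_p f = a_p(W) f` away from the level (newform + `aₙ(f) = aₙ(W)`)
  have hfT : ∀ (p : ℕ) (hp : p.Prime), ¬ p ∣ Nplus * Nminus →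
      (haveI : NeZero p := ⟨hp.ne_zero⟩; heckeT (Gamma0 (Nplus * Nminus)) 2 p f) =
        (fun n : ℕ => (W.LFunction n : ℂ)) p • f := by
    intro p hp _
    haveI : NeZero p := ⟨hp.ne_zero⟩
    rw [hf.1.heckeT_eq_coeff_smul hp]
    exact congrArg (· • f) (hf.2 p)
  -- `T_p (Θ_i φ) = a_p(W) Θ_i φ` (K2f + eigenvector + K2c)
  have hg : ∀ (p : ℕ) (hp : p.Prime), ¬ p ∣ Nplus * Nminus →
      (haveI : NeZero p := ⟨hp.ne_zero⟩;
        heckeT (Gamma0 (Nplus * Nminus)) 2 p (thetaLift hΘ S i φ)) =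
        (fun n : ℕ => (W.LFunction n : ℂ)) p • thetaLift hΘ S i φ := by
    intro p hp hpN
    have h := heckeT_thetaLift hΘ S i hp hpN hφdeg
    rw [hφ p hp hpN, thetaLift_smul hΘ S i _ φ hφdeg] at h
    exact h
  -- strong multiplicity one: `Θ_i φ = c • f`
  obtain ⟨c, hc⟩ := Submodule.mem_span_singleton.mp
    (mem_span_of_equiv_of_mem_newSubspace0 hf0 hf.1.1 hfT (thetaLift hΘ S i φ) hg)
  -- compare `a₁`: `a₁(Θ_i φ) = 2 w_i φ_i`, `a₁(c f) = c`
  have h1 : cuspCoeff (thetaLift hΘ S i φ) 1 = ((2 * (weight S.O i : ℤ) * φ i : ℤ) : ℂ) := by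
    rw [cuspCoeff_thetaLift hΘ S i hφdeg one_ne_zero, matrix_one S.O, Matrix.one_mulVec]
  have h2 : cuspCoeff (thetaLift hΘ S i φ) 1 = c := by
    have h3 : (UpperHalfPlane.qExpansion 1 ⇑f).coeff 1 = 1 := hf.1.2.2
    rw [← hc, cuspCoeff, qExpansion_coeff_smul, h3, mul_one]
  rw [← hc, ← h2, h1]

/-! ## §5 k2's PROVED kernel, recorded as `Prop`s (verbatim `ThetaTransferG4`, gen 4) -/

/-- **(β)+(T)** = `ThetaTransferG4.dvd_natAbs_mul_congruenceNumber_of_transfer` (PROVED). -/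
def KernelT : Prop :=
  ∀ (ι : Type) [Fintype ι] (N : ℕ) [NeZero N] (k : ℤ) (w : ι → ℕ) (φ : ι → ℤ) (ξ : ℕ), ξ ≠ 0 →
    ξ = ∑ c, w c * (φ c).natAbs ^ 2 → ∑ c, φ c = 0 →
    ∀ (f : CuspForm (Gamma0 N) k), f ≠ 0 → f ∈ integralCuspForms0 N k →
    ∀ (Θ : (ι → ℤ) → CuspForm (Gamma0 N) k),
      (∀ v v' : ι → ℤ, ∑ c, v c = 0 → ∑ c, v' c = 0 → Θ (v + v') = Θ v + Θ v') →
      (∀ (a : ℤ) (v : ι → ℤ), ∑ c, v c = 0 → Θ (a • v) = (a : ℂ) • Θ v) →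
      (∀ v : ι → ℤ, ∑ c, v c = 0 → Θ v ∈ integralCuspForms0 N k) →
    ∀ (m : ℤ), Θ φ = (m : ℂ) • f →
      (∀ z : ι → ℤ, ∑ c, z c = 0 → ∑ c, (w c : ℤ) * φ c * z c = 0 →
        peterssonProduct (Gamma0 N) k f (Θ z) = 0) →
    ∀ (y : ι → ℤ), ∑ c, y c = 0 →
      ξ ∣ (m * ∑ c, (w c : ℤ) * φ c * y c).natAbs * congruenceNumber f

/-- **H4a′** = `ThetaTransferG4.peterssonProduct_anemicHecke_symm` (PROVED). -/
def SelfAdjH4a : Prop :=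
  ∀ (N : ℕ) [NeZero N] (k : ℤ) (t : anemicHeckeRing N k) (f g : CuspForm (Gamma0 N) k),
    peterssonProduct (Gamma0 N) k ((t : Module.End ℂ (CuspForm (Gamma0 N) k)) f) g =
      peterssonProduct (Gamma0 N) k f ((t : Module.End ℂ (CuspForm (Gamma0 N) k)) g)

/-- **H4b′** = `ThetaTransferG4.exists_anemicHecke_transport` (PROVED). -/
def TransportH4b : Prop :=
  ∀ (ι : Type) [Fintype ι] [DecidableEq ι] (N : ℕ) [NeZero N] (k : ℤ) (T : ℕ → Matrix ι ι ℤ)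
    (Θ : (ι → ℤ) → CuspForm (Gamma0 N) k),
    (∀ p : ℕ, p.Prime → ¬ p ∣ N → ∀ v : ι → ℤ, ∑ c, v c = 0 → ∑ c, (T p *ᵥ v) c = 0) →
    (∀ v v' : ι → ℤ, ∑ c, v c = 0 → ∑ c, v' c = 0 → Θ (v + v') = Θ v + Θ v') →
    (∀ (a : ℤ) (v : ι → ℤ), ∑ c, v c = 0 → Θ (a • v) = (a : ℂ) • Θ v) →
    (∀ (p : ℕ) (hp : p.Prime), ¬ p ∣ N → ∀ v : ι → ℤ, ∑ c, v c = 0 →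
      (haveI : NeZero p := ⟨hp.ne_zero⟩; heckeT (Gamma0 N) k p (Θ v)) = Θ (T p *ᵥ v)) →
    ∀ (M : Matrix ι ι ℤ),
      M ∈ Algebra.adjoin ℤ {X : Matrix ι ι ℤ | ∃ p : ℕ, p.Prime ∧ ¬ p ∣ N ∧ X = T p} →
    ∃ t : anemicHeckeRing N k, ∀ v : ι → ℤ, ∑ c, v c = 0 →
      (t : Module.End ℂ (CuspForm (Gamma0 N) k)) (Θ v) = Θ (M *ᵥ v)

/-- **(O)** = `ThetaTransferG4.peterssonProduct_transfer_eq_zero` (PROVED). -/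
def OrthO : Prop :=
  ∀ (ι : Type) [Fintype ι] [DecidableEq ι] (N : ℕ) [NeZero N] (k : ℤ) (w : ι → ℕ) (φ : ι → ℤ)
    (ξ D : ℕ), ξ ≠ 0 → 0 < D → ξ = ∑ c, w c * (φ c).natAbs ^ 2 →
    ∀ (M : Matrix ι ι ℤ), (∀ c d : ι, (ξ : ℤ) * M c d = (D : ℤ) * (w d : ℤ) * φ d * φ c) →
    ∀ (f : CuspForm (Gamma0 N) k) (Θ : (ι → ℤ) → CuspForm (Gamma0 N) k),
      (∀ (a : ℤ) (v : ι → ℤ), ∑ c, v c = 0 → Θ (a • v) = (a : ℂ) • Θ v) →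
    ∀ (t : anemicHeckeRing N k),
      (∀ v : ι → ℤ, ∑ c, v c = 0 →
        (t : Module.End ℂ (CuspForm (Gamma0 N) k)) (Θ v) = Θ (M *ᵥ v)) →
      (∀ g g' : CuspForm (Gamma0 N) k,
        peterssonProduct (Gamma0 N) k ((t : Module.End ℂ (CuspForm (Gamma0 N) k)) g) g' =
          peterssonProduct (Gamma0 N) k g ((t : Module.End ℂ (CuspForm (Gamma0 N) k)) g')) →
    ∑ c, φ c = 0 → ∀ (m : ℤ), m ≠ 0 → Θ φ = (m : ℂ) • f →
    ∀ (z : ι → ℤ), ∑ c, z c = 0 → ∑ c, (w c : ℤ) * φ c * z c = 0 →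
      peterssonProduct (Gamma0 N) k f (Θ z) = 0


/-! ## §5b k2's PROVED kernel, VERBATIM COPY of `STUB_IDEAS_stub_xiDegreeComparison_2_SketchG4.lean`
(stub-ideation k=2, gen 4, namespace `…ThetaTransferG4`; author: seat k2) — copied here ONLY so that the
composition below is kernel-checked end-to-end in one file (crux workfiles are not importable).
Nothing in this block is k1's work. -/

namespace KernelK2G4


open scoped MatrixGroups ModularForm Matrix
open CongruenceSubgroup
open Literature.NumberTheory.EllipticCurves.ModularForms

/-! ## (β) the Brandt-free kernel: a congruence `ξ g ≡ n f (mod f^⊥)` forces `ξ ∣ |n| · r_f` -/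

/-- **(β) kernel lemma.** If `0 ≠ f`, `g` are integral cusp forms on `Γ₀(N)`, `h ∈ (ℤf)^⊥` and
`ξ • g = n • f + h` with `ξ ≠ 0`, then `ξ ∣ |n| · r_f`.  Proof: `d := gcd(ξ, n)`, `ξ = d ξ₁`,
`n = d n₁`, `u ξ₁ + v n₁ = 1`; `h' := ξ₁ g − n₁ f ∈ (ℤf)^⊥` (as `d • h' = h`); then
`f − (−v h') = ξ₁ • (u f + v g)`, so `ξ₁ ∣ r_f` (`dvd_congruenceNumber_of_sub_eq_smul`) and
`ξ = d ξ₁ ∣ |n| r_f`. -/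
theorem dvd_natAbs_mul_congruenceNumber_of_smul_eq {N : ℕ} [NeZero N] {k : ℤ}
    {f g h : CuspForm (Gamma0 N) k} (hf : f ≠ 0)
    (hfI : f ∈ integralCuspForms0 N k) (hgI : g ∈ integralCuspForms0 N k)
    (hh : h ∈ integralOrthogonal0 f) {ξ : ℕ} (hξ : ξ ≠ 0) {n : ℤ}
    (e : (ξ : ℂ) • g = (n : ℂ) • f + h) : ξ ∣ n.natAbs * congruenceNumber f := by
  -- `d = gcd(ξ, n) > 0`, `ξ = d ξ₁`, `n = d n₁`, `u ξ₁ + v n₁ = 1`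
  set d : ℕ := Int.gcd (ξ : ℤ) n with hd
  have hdpos : 0 < d := Int.gcd_pos_of_ne_zero_left n (by exact_mod_cast hξ)
  have hdξ : (d : ℤ) ∣ (ξ : ℤ) := Int.gcd_dvd_left _ _
  have hdn : (d : ℤ) ∣ n := Int.gcd_dvd_right _ _
  set ξ₁ : ℤ := (ξ : ℤ) / d with hξ₁
  set n₁ : ℤ := n / d with hn₁
  have hξd : (ξ : ℤ) = d * ξ₁ := (Int.mul_ediv_cancel' hdξ).symm
  have hnd : n = d * n₁ := (Int.mul_ediv_cancel' hdn).symm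
  have hcop : Int.gcd ξ₁ n₁ = 1 := Int.gcd_div_gcd_div_gcd hdpos
  obtain ⟨u, v, huv⟩ := Int.isCoprime_iff_gcd_eq_one.mpr hcop
  have hξ₁nn : 0 ≤ ξ₁ := Int.ediv_nonneg (by positivity) (by positivity)
  -- the Petersson pairing with `f`
  set P : CuspForm (Gamma0 N) k →ₗ[ℂ] ℂ := peterssonProductₗ (Gamma0 N) k f with hP
  have hPh : P h = 0 := (mem_integralOrthogonal0.mp hh).2
  -- `h' := ξ₁ g − n₁ f` is integral, and `d • h' = h` makes it orthogonal to `f`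
  set h' : CuspForm (Gamma0 N) k := (ξ₁ : ℂ) • g - (n₁ : ℂ) • f with hh'
  have hh'I : h' ∈ integralCuspForms0 N k := by
    rw [hh', Int.cast_smul_eq_zsmul, Int.cast_smul_eq_zsmul]
    exact Submodule.sub_mem _ (Submodule.smul_mem _ _ hgI) (Submodule.smul_mem _ _ hfI)
  have hdh' : (d : ℂ) • h' = h := by
    have e' : h = (ξ : ℂ) • g - (n : ℂ) • f := by rw [e]; abel
    have hξC : (ξ : ℂ) = (d : ℂ) * (ξ₁ : ℂ) := by exact_mod_cast hξd
    have hnC : (n : ℂ) = (d : ℂ) * (n₁ : ℂ) := by exact_mod_cast hnd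
    rw [e', hh', smul_sub, smul_smul, smul_smul, ← hξC, ← hnC]
  have hPh' : P h' = 0 := by
    have := congrArg P hdh'
    rw [map_smul, hPh, smul_eq_mul, mul_eq_zero] at this
    exact this.resolve_left (by exact_mod_cast hdpos.ne')
  have hh'orth : h' ∈ integralOrthogonal0 f := mem_integralOrthogonal0.mpr ⟨hh'I, hPh'⟩
  -- `f − (−v h') = ξ₁ • (u f + v g)`
  set r : ℕ := ξ₁.toNat with hr
  have hrξ₁ : (r : ℤ) = ξ₁ := Int.toNat_of_nonneg hξ₁nn
  have hrC : (r : ℂ) = (ξ₁ : ℂ) := by exact_mod_cast hrξ₁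
  have hg₁ : -(v • h') ∈ integralOrthogonal0 f :=
    (integralOrthogonal0 f).neg_mem ((integralOrthogonal0 f).smul_mem v hh'orth)
  have hh₁ : u • f + v • g ∈ integralCuspForms0 N k :=
    Submodule.add_mem _ (Submodule.smul_mem _ _ hfI) (Submodule.smul_mem _ _ hgI)
  have huvC : (u : ℂ) * ξ₁ + v * n₁ = 1 := by exact_mod_cast huv
  have key : f - -(v • h') = r • (u • f + v • g) := by
    rw [← Nat.cast_smul_eq_nsmul ℂ, hrC, ← Int.cast_smul_eq_zsmul ℂ v, ← Int.cast_smul_eq_zsmul ℂ u,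
      ← Int.cast_smul_eq_zsmul ℂ v, hh']
    match_scalars <;> first | ring1 | linear_combination -huvC
  have hr_dvd : r ∣ congruenceNumber f := dvd_congruenceNumber_of_sub_eq_smul hf hg₁ hh₁ key
  -- `ξ = d r ∣ |n| · r_f`
  have hξdr : ξ = d * r := by
    have : (ξ : ℤ) = d * r := by rw [hrξ₁]; exact hξd
    exact_mod_cast this
  have hdn' : d ∣ n.natAbs := Int.natCast_dvd.mp hdn
  rw [hξdr]
  exact Nat.mul_dvd_mul hdn' hr_dvd

/-! ## (T) the transfer template: gen 3's H2b + H3 + H4 are exactly its hypotheses -/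

/-- **(T) transfer template (Brandt-free).**  Let `w : ι → ℕ`, `φ : ι → ℤ`, `ξ ≠ 0` with
`ξ = Σ_c w_c |φ_c|²` (VERBATIM the shape of the tree's `Brandt.xi_eq_sum` on the eigen-line), `φ` of degree zero, and
`Θ : ℤ^ι → S_k(Γ₀(N))` additive and `ℤ`-homogeneous on degree-zero vectors, integral-valued there,
with `Θ φ = m • f` (H3: `m = 2 w_i φ_i`) and `Θ z ⊥ f` whenever `z` has degree zero and `⟨φ, z⟩_w = 0`
(H4).  Then for every degree-zero `y`: `ξ ∣ |m ⟨φ, y⟩_w| · r_f` — apply (β) to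
`ξ • Θ y = (m⟨φ,y⟩_w) • f + Θ(ξ y − ⟨φ,y⟩_w φ)`. -/
theorem dvd_natAbs_mul_congruenceNumber_of_transfer {ι : Type*} [Fintype ι] {N : ℕ} [NeZero N]
    {k : ℤ} (w : ι → ℕ) (φ : ι → ℤ) {ξ : ℕ} (hξ : ξ ≠ 0)
    (hξw : ξ = ∑ c, w c * (φ c).natAbs ^ 2)
    (hφ : ∑ c, φ c = 0) {f : CuspForm (Gamma0 N) k} (hf : f ≠ 0) (hfI : f ∈ integralCuspForms0 N k)
    (Θ : (ι → ℤ) → CuspForm (Gamma0 N) k)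
    (hadd : ∀ v v' : ι → ℤ, ∑ c, v c = 0 → ∑ c, v' c = 0 → Θ (v + v') = Θ v + Θ v')
    (hsmul : ∀ (a : ℤ) (v : ι → ℤ), ∑ c, v c = 0 → Θ (a • v) = (a : ℂ) • Θ v)
    (hint : ∀ v : ι → ℤ, ∑ c, v c = 0 → Θ v ∈ integralCuspForms0 N k)
    {m : ℤ} (hφf : Θ φ = (m : ℂ) • f)
    (horth : ∀ z : ι → ℤ, ∑ c, z c = 0 → ∑ c, (w c : ℤ) * φ c * z c = 0 →
      peterssonProduct (Gamma0 N) k f (Θ z) = 0)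
    {y : ι → ℤ} (hy : ∑ c, y c = 0) :
    ξ ∣ (m * ∑ c, (w c : ℤ) * φ c * y c).natAbs * congruenceNumber f := by
  -- `ξ = Σ w φ²` over `ℤ`
  have hξw' : (ξ : ℤ) = ∑ c, (w c : ℤ) * φ c * φ c := by
    rw [hξw]
    push_cast
    refine Finset.sum_congr rfl fun c _ => ?_
    rw [sq_abs]
    ring
  set s : ℤ := ∑ c, (w c : ℤ) * φ c * y c with hs
  -- `z := ξ y − ⟨φ,y⟩_w φ` has degree zero and is `w`-orthogonal to `φ`
  set z : ι → ℤ := ((ξ : ℤ) • y) + ((-s) • φ) with hz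
  have hξy : ∑ c, ((ξ : ℤ) • y) c = 0 := by
    simp only [Pi.smul_apply, smul_eq_mul, ← Finset.mul_sum, hy, mul_zero]
  have hsφ : ∑ c, ((-s) • φ) c = 0 := by
    simp only [Pi.smul_apply, smul_eq_mul, ← Finset.mul_sum, hφ, mul_zero]
  have hz0 : ∑ c, z c = 0 := by
    have : ∑ c, z c = ∑ c, ((ξ : ℤ) • y) c + ∑ c, ((-s) • φ) c := by
      rw [← Finset.sum_add_distrib]
      rfl
    rw [this, hξy, hsφ, add_zero]
  have hzorth : ∑ c, (w c : ℤ) * φ c * z c = 0 := by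
    have hc : ∀ c, (w c : ℤ) * φ c * z c =
        (ξ : ℤ) * ((w c : ℤ) * φ c * y c) - s * ((w c : ℤ) * φ c * φ c) := by
      intro c
      simp only [hz, Pi.add_apply, Pi.smul_apply, smul_eq_mul]
      ring
    simp_rw [hc, Finset.sum_sub_distrib, ← Finset.mul_sum, ← hξw', ← hs]
    ring
  -- `Θ z = ξ Θ y − (m s) f`, i.e. `ξ • Θ y = (m s) • f + Θ z`
  have hΘz : Θ z = (ξ : ℂ) • Θ y + ((-s : ℤ) : ℂ) • ((m : ℂ) • f) := by
    rw [hz, hadd _ _ hξy hsφ, hsmul _ _ hy, hsmul _ _ hφ, hφf]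
    push_cast
    rfl
  have e : (ξ : ℂ) • Θ y = ((m * s : ℤ) : ℂ) • f + Θ z := by
    rw [hΘz, smul_smul]
    push_cast
    module
  have hzO : Θ z ∈ integralOrthogonal0 f :=
    mem_integralOrthogonal0.mpr ⟨hint z hz0, horth z hz0 hzorth⟩
  exact dvd_natAbs_mul_congruenceNumber_of_smul_eq hf hfI (hint y hy) hzO hξ e

/-! ## H4 re-cut over the tree's anemic Hecke ring `𝕋 = ℤ[T_p : p ∤ N]` (`anemicHeckeRing N k`,
`HeckeCongruenceModulus.lean`): self-adjointness of `𝕋` (H4a′), transport of a Brandt-side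
polynomial in the `T(p)` to `𝕋` along any `T(p)`-equivariant `Θ` (H4b′), and the orthogonality
template (O) fed by the integral projector `ξ M = D φ φᵀ W` of `Brandt.exists_heckeProjector`. -/

/-- **H4a′ (S): every element of `𝕋 = ℤ[T_p : p ∤ N]` is Petersson-self-adjoint.**
`Algebra.adjoin_induction`: generators by `heckeT_selfAdjoint_holds` (Diamond–Shurman Thm. 5.5.3,
PROVED), `algebraMap ℤ` by (conjugate-)linearity at an integer, sums trivially, products by
`⟨st·f, g⟩ = ⟨t f, s g⟩ = ⟨f, t s g⟩` and commutativity of `𝕋` (`instCommRingAnemicHeckeRing`). -/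
theorem peterssonProduct_anemicHecke_symm {N : ℕ} [NeZero N] {k : ℤ} (t : anemicHeckeRing N k)
    (f g : CuspForm (Gamma0 N) k) :
    peterssonProduct (Gamma0 N) k ((t : Module.End ℂ (CuspForm (Gamma0 N) k)) f) g =
      peterssonProduct (Gamma0 N) k f ((t : Module.End ℂ (CuspForm (Gamma0 N) k)) g) := by
  obtain ⟨x, hx⟩ := t
  change peterssonProduct (Gamma0 N) k (x f) g = peterssonProduct (Gamma0 N) k f (x g)
  replace hx : x ∈ Algebra.adjoin ℤ (anemicHeckeGenerators N k) := hx
  induction hx using Algebra.adjoin_induction generalizing f g with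
  | mem y hy =>
    obtain ⟨p, hp, hpN, rfl⟩ := hy
    haveI : NeZero p := ⟨hp.ne_zero⟩
    exact heckeT_selfAdjoint_holds N k p hp hpN f g
  | algebraMap r =>
    rw [eq_intCast, Module.End.intCast_apply, Module.End.intCast_apply,
      ← Int.cast_smul_eq_zsmul ℂ, ← Int.cast_smul_eq_zsmul ℂ, peterssonProduct_smul_left,
      peterssonProduct_smul_right, map_intCast]
  | add x y hx hy ihx ihy =>
    rw [LinearMap.add_apply, LinearMap.add_apply, peterssonProduct_add_left,
      peterssonProduct_add_right, ihx, ihy]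
  | mul x y hx hy ihx ihy =>
    have hcomm : x * y = y * x :=
      congrArg Subtype.val (mul_comm (⟨x, hx⟩ : anemicHeckeRing N k) ⟨y, hy⟩)
    conv_rhs => rw [hcomm]
    rw [Module.End.mul_apply, Module.End.mul_apply, ihx, ihy]

/-- **H4b′ (S): transport along an equivariant lift.**  If `Θ` (additive and `ℤ`-homogeneous on the
degree-zero lattice, which the `T(p)`, `p ∤ N`, preserve) intertwines `T(p)` with `T_p` for every
prime `p ∤ N`, then every `M ∈ ℤ[T(p) : p ∤ N]` is intertwined with SOME `t ∈ 𝕋`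
(`Algebra.adjoin_induction`, or `Algebra.adjoin_eq_range` + `MvPolynomial.induction_on` as in
`anemicHeckeRing.exists_eq_aeval`). -/
theorem exists_anemicHecke_transport {ι : Type*} [Fintype ι] [DecidableEq ι] {N : ℕ} [NeZero N]
    {k : ℤ} (T : ℕ → Matrix ι ι ℤ) (Θ : (ι → ℤ) → CuspForm (Gamma0 N) k)
    (hdeg : ∀ p : ℕ, p.Prime → ¬ p ∣ N → ∀ v : ι → ℤ, ∑ c, v c = 0 → ∑ c, (T p *ᵥ v) c = 0)
    (hadd : ∀ v v' : ι → ℤ, ∑ c, v c = 0 → ∑ c, v' c = 0 → Θ (v + v') = Θ v + Θ v')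
    (hsmul : ∀ (a : ℤ) (v : ι → ℤ), ∑ c, v c = 0 → Θ (a • v) = (a : ℂ) • Θ v)
    (hequiv : ∀ (p : ℕ) (hp : p.Prime), ¬ p ∣ N → ∀ v : ι → ℤ, ∑ c, v c = 0 →
      (haveI : NeZero p := ⟨hp.ne_zero⟩; heckeT (Gamma0 N) k p (Θ v)) = Θ (T p *ᵥ v))
    {M : Matrix ι ι ℤ}
    (hM : M ∈ Algebra.adjoin ℤ {X : Matrix ι ι ℤ | ∃ p : ℕ, p.Prime ∧ ¬ p ∣ N ∧ X = T p}) :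
    ∃ t : anemicHeckeRing N k, ∀ v : ι → ℤ, ∑ c, v c = 0 →
      (t : Module.End ℂ (CuspForm (Gamma0 N) k)) (Θ v) = Θ (M *ᵥ v) := by
  -- induct on `M ∈ ℤ[T(p) : p ∤ N]`, carrying degree-preservation along
  suffices h : (∀ v : ι → ℤ, ∑ c, v c = 0 → ∑ c, (M *ᵥ v) c = 0) ∧
      ∃ t : anemicHeckeRing N k, ∀ v : ι → ℤ, ∑ c, v c = 0 →
        (t : Module.End ℂ (CuspForm (Gamma0 N) k)) (Θ v) = Θ (M *ᵥ v) from h.2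
  induction hM using Algebra.adjoin_induction with
  | mem X hX =>
    obtain ⟨p, hp, hpN, rfl⟩ := hX
    haveI : NeZero p := ⟨hp.ne_zero⟩
    exact ⟨hdeg p hp hpN, anemicHeckeRing.T N k p hp hpN, fun v hv => by
      rw [anemicHeckeRing.coe_T]; exact hequiv p hp hpN v hv⟩
  | algebraMap r =>
    have hr : ∀ v : ι → ℤ, (algebraMap ℤ (Matrix ι ι ℤ) r) *ᵥ v = r • v := fun v => by
      rw [Algebra.algebraMap_eq_smul_one, Matrix.smul_mulVec, Matrix.one_mulVec]
    refine ⟨fun v hv => ?_, algebraMap ℤ (anemicHeckeRing N k) r, fun v hv => ?_⟩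
    · rw [hr]
      simp only [Pi.smul_apply, smul_eq_mul, ← Finset.mul_sum, hv, mul_zero]
    · rw [hr, hsmul r v hv, Subalgebra.coe_algebraMap, eq_intCast, Module.End.intCast_apply,
        Int.cast_smul_eq_zsmul]
  | add X Y hX hY ihX ihY =>
    obtain ⟨hdX, tX, htX⟩ := ihX
    obtain ⟨hdY, tY, htY⟩ := ihY
    refine ⟨fun v hv => ?_, tX + tY, fun v hv => ?_⟩
    · rw [Matrix.add_mulVec, Finset.sum_congr rfl fun c _ => Pi.add_apply _ _ c,
        Finset.sum_add_distrib, hdX v hv, hdY v hv, add_zero]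
    · rw [Matrix.add_mulVec, hadd _ _ (hdX v hv) (hdY v hv), ← htX v hv, ← htY v hv,
        Subalgebra.coe_add, LinearMap.add_apply]
  | mul X Y hX hY ihX ihY =>
    obtain ⟨hdX, tX, htX⟩ := ihX
    obtain ⟨hdY, tY, htY⟩ := ihY
    refine ⟨fun v hv => ?_, tX * tY, fun v hv => ?_⟩
    · rw [← Matrix.mulVec_mulVec]
      exact hdX _ (hdY v hv)
    · rw [← Matrix.mulVec_mulVec, ← htX _ (hdY v hv), ← htY v hv, Subalgebra.coe_mul,
        Module.End.mul_apply]

/-- **(O) orthogonality template (S): `z ⊥_w φ ⟹ Θ z ⊥ f`.**  With the projector identity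
`ξ M_{cd} = D w_d φ_d φ_c` (`Brandt.exists_heckeProjector`, verbatim), `ξ = Σ w |φ|²`, a transported
`t ∈ 𝕋` for `M` (H4b′) and self-adjointness (H4a′): `M z = 0` and `M φ = D φ` (divide by `ξ ≠ 0`),
so `t (Θ φ) = D • Θ φ`, i.e. `t f = D f` (`m ≠ 0`), and
`D ⟨f, Θ z⟩ = ⟨t f, Θ z⟩ = ⟨f, t (Θ z)⟩ = ⟨f, Θ (M z)⟩ = ⟨f, Θ 0⟩ = 0`. -/
theorem peterssonProduct_transfer_eq_zero {ι : Type*} [Fintype ι] [DecidableEq ι] {N : ℕ}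
    [NeZero N] {k : ℤ} (w : ι → ℕ) (φ : ι → ℤ) {ξ D : ℕ} (hξ : ξ ≠ 0) (hD : 0 < D)
    (hξw : ξ = ∑ c, w c * (φ c).natAbs ^ 2) {M : Matrix ι ι ℤ}
    (hproj : ∀ c d : ι, (ξ : ℤ) * M c d = (D : ℤ) * (w d : ℤ) * φ d * φ c)
    {f : CuspForm (Gamma0 N) k} (Θ : (ι → ℤ) → CuspForm (Gamma0 N) k)
    (hsmul : ∀ (a : ℤ) (v : ι → ℤ), ∑ c, v c = 0 → Θ (a • v) = (a : ℂ) • Θ v)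
    {t : anemicHeckeRing N k}
    (ht : ∀ v : ι → ℤ, ∑ c, v c = 0 → (t : Module.End ℂ (CuspForm (Gamma0 N) k)) (Θ v) = Θ (M *ᵥ v))
    (hsymm : ∀ g g' : CuspForm (Gamma0 N) k,
      peterssonProduct (Gamma0 N) k ((t : Module.End ℂ (CuspForm (Gamma0 N) k)) g) g' =
        peterssonProduct (Gamma0 N) k g ((t : Module.End ℂ (CuspForm (Gamma0 N) k)) g'))
    (hφ : ∑ c, φ c = 0) {m : ℤ} (hm : m ≠ 0) (hφf : Θ φ = (m : ℂ) • f)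
    {z : ι → ℤ} (hz : ∑ c, z c = 0) (hzorth : ∑ c, (w c : ℤ) * φ c * z c = 0) :
    peterssonProduct (Gamma0 N) k f (Θ z) = 0 := by
  have hξ0 : (ξ : ℤ) ≠ 0 := by exact_mod_cast hξ
  -- `ξ = Σ w φ²` over `ℤ`
  have hξw' : (ξ : ℤ) = ∑ c, (w c : ℤ) * φ c * φ c := by
    rw [hξw]
    push_cast
    refine Finset.sum_congr rfl fun c _ => ?_
    rw [sq_abs]
    ring
  -- `M z = 0` and `M φ = D φ`
  have hMz : M *ᵥ z = 0 := by
    funext c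
    have h1 : (ξ : ℤ) * (M *ᵥ z) c = 0 := by
      simp only [Matrix.mulVec, dotProduct, Finset.mul_sum]
      have hc : ∀ d, (ξ : ℤ) * (M c d * z d) = (D : ℤ) * φ c * ((w d : ℤ) * φ d * z d) := by
        intro d
        rw [← mul_assoc, hproj]
        ring
      simp_rw [hc, ← Finset.mul_sum, hzorth, mul_zero]
    exact (mul_eq_zero.mp h1).resolve_left hξ0
  have hMφ : M *ᵥ φ = (D : ℤ) • φ := by
    funext c
    have h1 : (ξ : ℤ) * (M *ᵥ φ) c = (ξ : ℤ) * ((D : ℤ) * φ c) := by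
      simp only [Matrix.mulVec, dotProduct, Finset.mul_sum]
      have hc : ∀ d, (ξ : ℤ) * (M c d * φ d) = (D : ℤ) * φ c * ((w d : ℤ) * φ d * φ d) := by
        intro d
        rw [← mul_assoc, hproj]
        ring
      simp_rw [hc, ← Finset.mul_sum, ← hξw']
      ring
    rw [Pi.smul_apply, smul_eq_mul]
    exact mul_left_cancel₀ hξ0 h1
  -- `t f = D f`
  have htφ : (t : Module.End ℂ (CuspForm (Gamma0 N) k)) (Θ φ) = (D : ℂ) • Θ φ := by
    rw [ht φ hφ, hMφ, hsmul _ _ hφ]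
    push_cast
    rfl
  have hm0 : (m : ℂ) ≠ 0 := by exact_mod_cast hm
  have htf : (t : Module.End ℂ (CuspForm (Gamma0 N) k)) f = (D : ℂ) • f := by
    have h1 : (m : ℂ) • (t : Module.End ℂ (CuspForm (Gamma0 N) k)) f = (m : ℂ) • ((D : ℂ) • f) := by
      rw [← map_smul, ← hφf, htφ, hφf, smul_comm]
    exact smul_right_injective _ hm0 h1
  -- `t (Θ z) = 0`
  have hΘ0 : Θ 0 = 0 := by
    have h0 := hsmul 0 z hz
    rw [zero_smul, Int.cast_zero, zero_smul] at h0
    exact h0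
  have htz : (t : Module.End ℂ (CuspForm (Gamma0 N) k)) (Θ z) = 0 := by
    rw [ht z hz, hMz, hΘ0]
  -- `D ⟨f, Θ z⟩ = ⟨D f, Θ z⟩ = ⟨t f, Θ z⟩ = ⟨f, t Θ z⟩ = 0`
  have key : (starRingEnd ℂ) (D : ℂ) * peterssonProduct (Gamma0 N) k f (Θ z) = 0 := by
    rw [← peterssonProduct_smul_left, ← htf, hsymm, htz, peterssonProduct_zero_right]
  have hD0 : (starRingEnd ℂ) (D : ℂ) ≠ 0 := by
    rw [Complex.conj_natCast]
    exact_mod_cast hD.ne'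
  exact (mul_eq_zero.mp key).resolve_left hD0

end KernelK2G4

/-! ## §5c the four templates ARE k2's theorems (bridging, PROVED) -/

theorem kernelT_holds : KernelT :=
  fun _ _ _ _ _ w φ _ hξ hξw hφ _ hf hfI Θ hadd hsmul hint _ hφf horth _ hy =>
    KernelK2G4.dvd_natAbs_mul_congruenceNumber_of_transfer w φ hξ hξw hφ hf hfI Θ hadd hsmul hint
      hφf horth hy

theorem selfAdjH4a_holds : SelfAdjH4a :=
  fun _ _ _ t f g => KernelK2G4.peterssonProduct_anemicHecke_symm t f g

theorem transportH4b_holds : TransportH4b :=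
  fun _ _ _ _ _ _ T Θ hdeg hadd hsmul hequiv _ hM =>
    KernelK2G4.exists_anemicHecke_transport T Θ hdeg hadd hsmul hequiv hM

theorem orthO_holds : OrthO :=
  fun _ _ _ _ _ _ w φ _ _ hξ hD hξw _ hproj _ Θ hsmul _ ht hsymm hφ _ hm hφf _ hz hzorth =>
    KernelK2G4.peterssonProduct_transfer_eq_zero w φ hξ hD hξw hproj Θ hsmul ht hsymm hφ hm hφf hz
      hzorth

/-! ## §6 K5 — the composition into k3's `XiCoreDivisibility` (the interface test) -/

/-- k3 `ProbeExtremesG4.XiCoreDivisibility`, VERBATIM. -/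
def XiCoreDivisibility : Prop :=
  ∀ (Nplus Nminus M : ℕ) [NeZero M], Nplus * Nminus = M →
    ∀ (S : XiSetup Nplus Nminus) [Fintype (ClassSet S.O)] (W : WeierstrassCurve ℚ) [W.IsElliptic]
      (f : CuspForm (Gamma0 M) 2), IsNewformOf W f →
    ∀ (φ : ClassSet S.O → ℤ), φ ≠ 0 →
      eigenLattice (Nplus * Nminus) (matrix S.O) (fun n => W.LFunction n) = ℤ ∙ φ →
    ∀ (i : ClassSet S.O) (y : ClassSet S.O → ℤ), ∑ c, y c = 0 →
      (S.xi fun n => W.LFunction n) ∣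
        (2 * (weight S.O i : ℤ) * φ i * ∑ c, (weight S.O c : ℤ) * φ c * y c).natAbs *
          congruenceNumber f

/-- **K5 (S · assembly of the theta side, PROVED modulo K2d–K2f, K3).**
`H1 → (T) → H4a′ → H4b′ → (O) → XiCoreDivisibility`.  ORDER: `subst` the level; `φ ∈ L`, `deg φ = 0`
(`XiSetup.sum_eq_zero_of_eigenLattice_lFunction_eq_span`); `ξ = Σ w φ²` (`XiSetup.xi`, `xiOfOrder_eq`,
`xi_eq_sum`) hence `ξ ≠ 0` (`one_le_weight`, `φ ≠ 0`); `f ≠ 0`, `f` integral (`IsNewformOf`); row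
`φ_i = 0` vacuous; `m := 2 w_i φ_i ≠ 0`; H3; the ABSTRACT projector `Brandt.exists_heckeProjector`
(anemic `adjoin`, as H4b′ wants); transport `t` (H4b′ with K2b/K2c/K2f/K2g); (O) with H4a′; (T). -/
theorem xiCoreDivisibility_of_thetaSide (hΘ : H1) (hT : KernelT) (h4a : SelfAdjH4a)
    (h4b : TransportH4b) (hO : OrthO) : XiCoreDivisibility := by
  classical
  intro Nplus Nminus M _ hM S _ W _ f hf φ hφ0 hL i y hy
  subst hM
  -- the eigenvector: in the lattice, degree zero
  have hφL : φ ∈ eigenLattice (Nplus * Nminus) (matrix S.O) (fun n => W.LFunction n) := by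
    rw [hL]; exact Submodule.mem_span_singleton_self φ
  have hφdeg : ∑ c, φ c = 0 := S.sum_eq_zero_of_eigenLattice_lFunction_eq_span W hL
  -- ξ = Σ w φ² ≠ 0
  have hξw : (S.xi fun n => W.LFunction n) = ∑ c, weight S.O c * (φ c).natAbs ^ 2 := by
    rw [XiSetup.xi, xiOfOrder_eq]
    exact xi_eq_sum _ hφ0 hL
  have hξ : (S.xi fun n => W.LFunction n) ≠ 0 := by
    rw [hξw]
    obtain ⟨c, hc⟩ := Function.ne_iff.mp hφ0
    have hpos : 0 < weight S.O c * (φ c).natAbs ^ 2 :=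
      Nat.mul_pos (S.one_le_weight c) (pow_pos (Int.natAbs_pos.mpr hc) 2)
    have hle : weight S.O c * (φ c).natAbs ^ 2 ≤ ∑ c, weight S.O c * (φ c).natAbs ^ 2 :=
      Finset.single_le_sum (f := fun c => weight S.O c * (φ c).natAbs ^ 2)
        (fun _ _ => Nat.zero_le _) (Finset.mem_univ c)
    exact (lt_of_lt_of_le hpos hle).ne'
  -- the newform: nonzero, integral
  have hf0 : f ≠ 0 := IsNormalized.ne_zero_gamma0 hf.1.2.2
  have hfI : f ∈ integralCuspForms0 (Nplus * Nminus) 2 := fun n => ⟨W.LFunction n, (hf.2 n).symm⟩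
  -- the vacuous row
  by_cases hφi : φ i = 0
  · rw [hφi, mul_zero, zero_mul, Int.natAbs_zero, zero_mul]
    exact dvd_zero _
  have hwi : (weight S.O i : ℤ) ≠ 0 := by
    have := S.one_le_weight i
    exact_mod_cast (by omega : weight S.O i ≠ 0)
  have hm : (2 * (weight S.O i : ℤ) * φ i) ≠ 0 := mul_ne_zero (mul_ne_zero two_ne_zero hwi) hφi
  -- H3
  have hφf := thetaLift_eq_smul_of_isNewformOf hΘ S i W hf hφL
  -- the integral Hecke projector, in the ANEMIC Hecke algebra
  obtain ⟨D, hD, Mx, hMx, hproj⟩ := Brandt.exists_heckeProjector (weight S.O)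
    (fun c => S.one_le_weight c) (Nplus * Nminus) (matrix S.O)
    (fun p _ _ c d => S.weight_mul_matrix_symm p c d) (fun n => W.LFunction n) hφ0 hL
  have hproj' : ∀ c d : ClassSet S.O, ((S.xi fun n => W.LFunction n : ℕ) : ℤ) * Mx c d =
      (D : ℤ) * (weight S.O d : ℤ) * φ d * φ c := by
    intro c d
    rw [XiSetup.xi, xiOfOrder_eq]
    exact hproj c d
  -- transport of the projector to `𝕋`
  obtain ⟨t, ht⟩ := h4b (ClassSet S.O) (Nplus * Nminus) 2 (matrix S.O) (thetaLift hΘ S i)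
    (fun p hp hpN v hv => sum_matrix_mulVec_eq_zero S hp hpN hv)
    (thetaLift_add hΘ S i) (thetaLift_smul hΘ S i)
    (fun p hp hpN v hv => heckeT_thetaLift hΘ S i hp hpN hv) Mx hMx
  -- orthogonality
  have horth : ∀ z : ClassSet S.O → ℤ, ∑ c, z c = 0 →
      ∑ c, (weight S.O c : ℤ) * φ c * z c = 0 →
      peterssonProduct (Gamma0 (Nplus * Nminus)) 2 f (thetaLift hΘ S i z) = 0 :=
    fun z hz hzo => hO (ClassSet S.O) (Nplus * Nminus) 2 (weight S.O) φ _ D hξ hD hξw Mx hproj' f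
      (thetaLift hΘ S i) (thetaLift_smul hΘ S i) t ht (h4a _ 2 t) hφdeg _ hm hφf z hz hzo
  -- the kernel
  exact hT (ClassSet S.O) (Nplus * Nminus) 2 (weight S.O) φ _ hξ hξw hφdeg f hf0 hfI
    (thetaLift hΘ S i) (thetaLift_add hΘ S i) (thetaLift_smul hΘ S i)
    (fun v hv => thetaLift_mem_integralCuspForms0 hΘ S i hv) _ hφf horth y hy

/-- **THE THETA SIDE IS CLOSED: `H1 → XiCoreDivisibility`** (k1 gen 9 H1 ⊕ k1 gen 10 theta package ⊕
k2 gen 4 kernel), kernel-checked in this file with H1 the only hypothesis — and H1 is PROVED in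
`STUB_IDEAS_stub_xiDegreeComparison_1_g9_H1complete.lean` (`StubIdeasK1G9.thetaTransfer_H1`, 0 sorries). -/
theorem xiCoreDivisibility_of_H1 (hΘ : H1) : XiCoreDivisibility :=
  xiCoreDivisibility_of_thetaSide hΘ kernelT_holds selfAdjH4a_holds transportH4b_holds orthO_holds

/-! ## §7 The last arrow (k3 `ProbeExtremesG4.stub_xiDegreeComparison_of_core`, L7):
`stub_xiDegreeComparison ⟸ XiCoreDivisibility ∧ ARS 2.1(b) ∧ FreyModularity`; so the stub's trust base
after gen 10 is exactly {`padicValNat_congruenceNumber_eq_of_not_sq_dvd` (named fact, ARS 2012 Thm 2.1(b)),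
`Summit.ABC.ABC.Theses.DefiniteXi.FreyModularity` (route item stmt-ABC-11340)} plus ONLY k3's gen-4
S/XS sorries L3 (least prime `ℓ ∤ N` is `≤ C_ε N^ε`), L5 (`cps` bookkeeping), L6 (ARS (b) at the optimal
datum), L7 (assembly) — `XiCoreDivisibility` itself is now a theorem (`xiCoreDivisibility_of_H1` here +
`StubIdeasK1G9.thetaTransfer_H1`; single-file certificate `…_1_g10_XiCoreComplete.lean`). -/

end Summit.ABC.ABC.Cruxes.SteinbergCore.StubIdeasK1G10

end
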